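import Summits.RiemannHypothesis.RiemannHypothesis.Theorems.SoloInformedPoleFree
import Mathlib.Analysis.Normed.Group.Tannery

/-!
# RH as an eigenvalue count: the Markov part of Weil's form has at most one bound state

Solo programme `solo-RiemannHypothesis-informed`, session 14. Everything here is proved.

Write Weil's hermitian form as `Re Q(g) = P(g) + Q₀(g)` with the pole form
`P(g) = 2|∫ g cosh(t/2)|² − 2|∫ g sinh(t/2)|²` (signature `(1,1)`) and the **Markov part**
`Q₀ = weilMarkovQuadratic`; on every window `[-a, a]`, `Q₀(g) = 𝓔_a(g) − M_a ‖g‖₂²` with `𝓔_a` a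
pure-jump Dirichlet form (jump rates `Λ(n) n^{-1/2}` at the lengths `log n`, archimedean density
`e^{t/2}/(2 sinh t)`) and `M_a` the killing constant (`WeilMarkovQuadratic.lean`).

This file: the forward direction and the tools; the equivalence
`riemannHypothesis_iff_markovIndex_le_one` (**`RH` holds if and only if `Q₀` has no
two-dimensional negative definite subspace of test functions** — for all tests `g, h` some
non-trivial combination `α g + β h` has `Q₀(α g + β h) ≥ 0`; equivalently, for every `a` the
self-adjoint operator of the Markovian jump form `𝓔_a` on `L²(-a, a)` has at most one eigenvalue
below the killing rate `M_a`) and the unconditional negative vector are assembled in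
`SoloInformedMarkovBoundState.lean`.

* `markovIndex_le_one_of_riemannHypothesis`: under RH, among any two tests some non-trivial
  combination has `Q₀ ≥ 0`.
* `tendsto_zeroSum_of_growth`: Tannery over the non-trivial zeros — a zero sum whose `ρ`-th term
  grows at most like `e^{2θ|Re ρ − 1/2| a}` is `o(e^{θ a})`.
* `weilMellin_twoBump`, `norm_twoExp_le`, `exists_isWeilTest_weilMellin_zero_one_pos`: the
  two-bump test `u(· − a) + u(· + a)` and its Mellin factor `e^{(s−1/2)a} + e^{−(s−1/2)a}`.

Proof. (⇒) any two-dimensional space contains `v ≠ 0` with `∫ v cosh(t/2) = 0`, and then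
`Q₀(v) = Re Q(v) + 2|∫ v sinh(t/2)|² ≥ 0` by Weil's criterion. (⇐) if RH fails, the pole-free
criterion (`riemannHypothesis_iff_poleFree`) gives a pole-free test `w` with `Re Q(w) = −q < 0`;
with `e_a = u(· − a) + u(· + a)` for a fixed bump `u`, the Gram matrix of `Q₀` on `(w, e_a)` is
`[[−q, O(X_a)], [O(X_a), Re Q(e_a) − (e^{a/2} + e^{-a/2})² û(0) û(1)]]` with
`X_a = o(e^{a/2})` and `Re Q(e_a) = o(e^{a})` — Tannery's theorem over the zeros, each zero
contributing `e^{a |Re ρ − 1/2|}` with `|Re ρ − 1/2| < 1/2` — hence negative definite for large `a`.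

Census remark (F35 of the programme): under RH the count is decided at the SECOND eigenvalue, which
lies within the ground energy of the pole-free class of `0` — super-exponentially small in `a` — so
no spectral-gap technique with a constant-factor loss (Cheeger, coupling, Lyapunov–Poincaré) can
certify it; the reformulation moves Weil positivity from a constrained subspace, where Markov
tools do not act, to an eigenvalue count for an honest Markov generator, where they act but are
not sharp.

References: E. Bombieri, *Remarks on Weil's quadratic functional in the theory of prime numbers I*,
Rend. Mat. Acc. Lincei (9) 11 (2000) 183–233, Thms. 1–2; H. Yoshida, *On Hermitian forms attached
to zeta functions*, Adv. Stud. Pure Math. 21 (1992), §6.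
-/

noncomputable section

open Complex Filter Set MeasureTheory
open scoped Real Topology ComplexConjugate

namespace Summit.RiemannHypothesis.RiemannHypothesis.Theorems

open Literature.NumberTheory.LFunctions Literature.NumberTheory.LFunctions.WeilConverse

/-! ## Linear combinations of test functions -/

/-- `α g + β h` is a test function. [folklore] -/
theorem isWeilTest_lin {g h : ℝ → ℂ} (hg : IsWeilTest g) (hh : IsWeilTest h) (α β : ℂ) :
    IsWeilTest fun t ↦ α * g t + β * h t :=
  (hg.const_mul α).add (hh.const_mul β)

/-- `(α g + β h)^(s) = α ĝ(s) + β ĥ(s)`. [folklore] -/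
theorem weilMellin_lin {g h : ℝ → ℂ} (hg : IsWeilTest g) (hh : IsWeilTest h) (α β s : ℂ) :
    weilMellin (fun t ↦ α * g t + β * h t) s = α * weilMellin g s + β * weilMellin h s := by
  have e : (fun t ↦ α * g t + β * h t) = (fun t ↦ α * g t) + fun t ↦ β * h t := rfl
  rw [e, weilMellin_add (hg.const_mul α).1.continuous (hg.const_mul α).2
    (hh.const_mul β).1.continuous (hh.const_mul β).2, weilMellin_const_mul, weilMellin_const_mul]

/-- `∫ g cosh(t/2) = (ĝ(1) + ĝ(0))/2`. [folklore] -/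
theorem integral_mul_cosh_eq {g : ℝ → ℂ} (hg : IsWeilTest g) :
    ∫ t : ℝ, g t * (Real.cosh (t / 2) : ℂ) = (weilMellin g 1 + weilMellin g 0) / 2 := by
  rw [weilMellin_one_eq_cosh_add_sinh hg, weilMellin_zero_eq_cosh_sub_sinh hg]
  ring

/-- If `ĝ(1) + ĝ(0) = 0` (`g ⊥ cosh(t/2)`) then `P(g) = −2|∫ g sinh(t/2)|² ≤ 0`. [folklore] -/
theorem weilPoleForm_nonpos_of_cosh {g : ℝ → ℂ} (hg : IsWeilTest g)
    (h : weilMellin g 1 + weilMellin g 0 = 0) : weilPoleForm g ≤ 0 := by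
  have h0 : ∫ t : ℝ, g t * (Real.cosh (t / 2) : ℂ) = 0 := by
    rw [integral_mul_cosh_eq hg, h, zero_div]
  rw [weilPoleForm, h0, norm_zero]
  nlinarith [sq_nonneg ‖∫ t : ℝ, g t * (Real.sinh (t / 2) : ℂ)‖]

/-! ## `RH ⟹` the Markov part has negative index at most one -/

/-- Under RH, among any two tests some non-trivial combination `v` has `Q₀(v) ≥ 0`: take `v` with
`∫ v cosh(t/2) = 0`; then `Q₀(v) = Re Q(v) + 2|∫ v sinh(t/2)|² ≥ 0`. [folklore] -/
theorem markovIndex_le_one_of_riemannHypothesis (hRH : RiemannHypothesis) {g h : ℝ → ℂ}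
    (hg : IsWeilTest g) (hh : IsWeilTest h) :
    ∃ α β : ℂ, (α ≠ 0 ∨ β ≠ 0) ∧ 0 ≤ weilMarkovQuadratic fun t ↦ α * g t + β * h t := by
  obtain ⟨α, β, hne, hC⟩ : ∃ α β : ℂ, (α ≠ 0 ∨ β ≠ 0) ∧
      α * (weilMellin g 1 + weilMellin g 0) + β * (weilMellin h 1 + weilMellin h 0) = 0 := by
    by_cases hCg : weilMellin g 1 + weilMellin g 0 = 0
    · exact ⟨1, 0, Or.inl one_ne_zero, by rw [hCg]; ring⟩
    · exact ⟨weilMellin h 1 + weilMellin h 0, -(weilMellin g 1 + weilMellin g 0),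
        Or.inr (neg_ne_zero.2 hCg), by ring⟩
  refine ⟨α, β, hne, ?_⟩
  have hv := isWeilTest_lin hg hh α β
  have hP : weilPoleForm (fun t ↦ α * g t + β * h t) ≤ 0 := by
    refine weilPoleForm_nonpos_of_cosh hv ?_
    rw [weilMellin_lin hg hh, weilMellin_lin hg hh]
    linear_combination hC
  have hQ : 0 ≤ (weilQuadratic fun t ↦ α * g t + β * h t).re := weil_criterion_holds.1 hRH _ hv
  rw [weilMarkovQuadratic]
  linarith

/-! ## Tannery's theorem over the zeros -/

/-- **Tannery over the non-trivial zeros.** If `∑_ρ m(ρ)|c(ρ)| < ∞` and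
`|Φ_a(ρ)| ≤ M e^{2θ|Re ρ − 1/2| a}` (`a ≥ 0`), then `e^{-θ a} ∑_ρ m(ρ) c(ρ) Φ_a(ρ) → 0` as
`a → ∞`: each zero has `|Re ρ − 1/2| < 1/2`, so each term decays exponentially, and the family is
dominated by `M ∑ m|c|`. [folklore] -/
theorem tendsto_zeroSum_of_growth {c : ℂ → ℂ} {Φ : ℝ → ℂ → ℂ} {θ M : ℝ} (hθ : 0 < θ)
    (hM : 0 ≤ M)
    (hc : Summable fun ρ : ZetaZeros.riemannZetaNontrivialZeros ↦
      ‖(riemannZetaZeroOrder (ρ : ℂ) : ℂ) * c ρ‖)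
    (hΦ : ∀ a : ℝ, 0 ≤ a → ∀ ρ ∈ ZetaZeros.riemannZetaNontrivialZeros,
      ‖Φ a ρ‖ ≤ M * Real.exp (2 * θ * |ρ.re - 1 / 2| * a)) :
    Tendsto (fun a : ℝ ↦ (Real.exp (-(θ * a)) : ℂ) *
      ∑' ρ : ZetaZeros.riemannZetaNontrivialZeros,
        (riemannZetaZeroOrder (ρ : ℂ) : ℂ) * c ρ * Φ a ρ) atTop (𝓝 0) := by
  set F : ℝ → ZetaZeros.riemannZetaNontrivialZeros → ℂ := fun a ρ ↦
    (Real.exp (-(θ * a)) : ℂ) * ((riemannZetaZeroOrder (ρ : ℂ) : ℂ) * c ρ * Φ a ρ) with hF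
  have hFsum : (fun a : ℝ ↦ (Real.exp (-(θ * a)) : ℂ) *
      ∑' ρ : ZetaZeros.riemannZetaNontrivialZeros,
        (riemannZetaZeroOrder (ρ : ℂ) : ℂ) * c ρ * Φ a ρ) = fun a ↦ ∑' ρ, F a ρ := by
    funext a
    rw [hF]
    exact tsum_mul_left.symm
  rw [hFsum, show (0 : ℂ) = ∑' _ : ZetaZeros.riemannZetaNontrivialZeros, (0 : ℂ) by
    rw [tsum_zero]]
  -- the termwise bound `‖F a ρ‖ ≤ ‖m c‖ M e^{θ(2|σ-1/2|-1) a}` for `a ≥ 0`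
  have hnorm : ∀ a : ℝ, 0 ≤ a → ∀ ρ : ZetaZeros.riemannZetaNontrivialZeros,
      ‖F a ρ‖ ≤ ‖(riemannZetaZeroOrder (ρ : ℂ) : ℂ) * c ρ‖ *
        (M * Real.exp (θ * (2 * |(ρ : ℂ).re - 1 / 2| - 1) * a)) := by
    intro a ha ρ
    rw [hF]
    dsimp only
    rw [norm_mul, norm_mul, Complex.norm_real, Real.norm_eq_abs, abs_of_pos (Real.exp_pos _)]
    calc Real.exp (-(θ * a)) * (‖(riemannZetaZeroOrder (ρ : ℂ) : ℂ) * c ρ‖ * ‖Φ a ρ‖)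
        ≤ Real.exp (-(θ * a)) * (‖(riemannZetaZeroOrder (ρ : ℂ) : ℂ) * c ρ‖ *
            (M * Real.exp (2 * θ * |(ρ : ℂ).re - 1 / 2| * a))) := by
          gcongr
          exact hΦ a ha ρ ρ.2
      _ = ‖(riemannZetaZeroOrder (ρ : ℂ) : ℂ) * c ρ‖ *
            (M * (Real.exp (2 * θ * |(ρ : ℂ).re - 1 / 2| * a) * Real.exp (-(θ * a)))) := by
          ring
      _ = ‖(riemannZetaZeroOrder (ρ : ℂ) : ℂ) * c ρ‖ *
            (M * Real.exp (θ * (2 * |(ρ : ℂ).re - 1 / 2| - 1) * a)) := by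
          rw [← Real.exp_add]
          congr 3
          ring
  have hlt : ∀ ρ : ZetaZeros.riemannZetaNontrivialZeros,
      θ * (2 * |(ρ : ℂ).re - 1 / 2| - 1) < 0 := fun ρ ↦ by
    have h1 := ZetaZeros.riemannZetaNontrivialZeros.re_pos ρ.2
    have h2 := ZetaZeros.riemannZetaNontrivialZeros.re_lt_one ρ.2
    have h3 : |(ρ : ℂ).re - 1 / 2| < 1 / 2 := abs_sub_lt_iff.2 ⟨by linarith, by linarith⟩
    exact mul_neg_of_pos_of_neg hθ (by linarith)
  refine tendsto_tsum_of_dominated_convergence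
    (bound := fun ρ ↦ ‖(riemannZetaZeroOrder (ρ : ℂ) : ℂ) * c ρ‖ * M) (hc.mul_right M)
    (fun ρ ↦ ?_) ?_
  · -- termwise limit `0`
    refine squeeze_zero_norm' ((eventually_ge_atTop 0).mono fun a ha ↦ hnorm a ha ρ) ?_
    have h := ((Real.tendsto_exp_atBot.comp
      ((tendsto_id (α := ℝ)).const_mul_atTop_of_neg (hlt ρ))).const_mul M).const_mul
      ‖(riemannZetaZeroOrder (ρ : ℂ) : ℂ) * c ρ‖
    simpa using h
  · -- domination for `a ≥ 0`
    filter_upwards [eventually_ge_atTop 0] with a ha ρ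
    refine (hnorm a ha ρ).trans (mul_le_mul_of_nonneg_left ?_ (norm_nonneg _))
    have : Real.exp (θ * (2 * |(ρ : ℂ).re - 1 / 2| - 1) * a) ≤ 1 :=
      Real.exp_le_one_iff.2 (mul_nonpos_of_nonpos_of_nonneg (hlt ρ).le ha)
    nlinarith

/-! ## Two far-apart bumps -/

/-- `|e^{(s−1/2)a} + e^{−(s−1/2)a}| ≤ 2 e^{|Re s − 1/2| a}` for `a ≥ 0`. [folklore] -/
theorem norm_twoExp_le (s : ℂ) {a : ℝ} (ha : 0 ≤ a) :
    ‖cexp ((s - 1 / 2) * a) + cexp ((s - 1 / 2) * ((-a : ℝ) : ℂ))‖ ≤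
      2 * Real.exp (|s.re - 1 / 2| * a) := by
  have hre : ∀ b : ℝ, ((s - 1 / 2) * (b : ℂ)).re = (s.re - 1 / 2) * b := fun b ↦ by
    simp [Complex.mul_re]
  refine (norm_add_le _ _).trans ?_
  rw [Complex.norm_exp, Complex.norm_exp, hre, hre]
  have h1 : Real.exp ((s.re - 1 / 2) * a) ≤ Real.exp (|s.re - 1 / 2| * a) :=
    Real.exp_le_exp.2 (mul_le_mul_of_nonneg_right (le_abs_self _) ha)
  have h2 : Real.exp ((s.re - 1 / 2) * -a) ≤ Real.exp (|s.re - 1 / 2| * a) := by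
    refine Real.exp_le_exp.2 ?_
    rw [mul_neg, ← neg_mul]
    exact mul_le_mul_of_nonneg_right (neg_le_abs _) ha
  linarith

/-- The transform of the two-bump function `u(· − a) + u(· + a)`:
`(e^{(s−1/2)a} + e^{−(s−1/2)a}) û(s)`. [folklore] -/
theorem weilMellin_twoBump {u : ℝ → ℂ} (hu : IsWeilTest u) (a : ℝ) (s : ℂ) :
    weilMellin (weilTranslate u a + weilTranslate u (-a)) s =
      (cexp ((s - 1 / 2) * a) + cexp ((s - 1 / 2) * ((-a : ℝ) : ℂ))) * weilMellin u s := by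
  rw [weilMellin_add (hu.weilTranslate a).1.continuous (hu.weilTranslate a).2
      (hu.weilTranslate (-a)).1.continuous (hu.weilTranslate (-a)).2,
    weilMellin_weilTranslate, weilMellin_weilTranslate]
  ring

/-- At `s = 0` and `s = 1` the two-bump factor is the real number `e^{a/2} + e^{-a/2}`.
[folklore] -/
theorem twoExp_zero_one (a : ℝ) :
    cexp ((0 - 1 / 2) * (a : ℂ)) + cexp ((0 - 1 / 2) * ((-a : ℝ) : ℂ)) =
        ((Real.exp (a / 2) + Real.exp (-(a / 2)) : ℝ) : ℂ) ∧
      cexp ((1 - 1 / 2) * (a : ℂ)) + cexp ((1 - 1 / 2) * ((-a : ℝ) : ℂ)) =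
        ((Real.exp (a / 2) + Real.exp (-(a / 2)) : ℝ) : ℂ) := by
  have e1 : cexp ((0 - 1 / 2) * (a : ℂ)) = ((Real.exp (-(a / 2)) : ℝ) : ℂ) := by
    rw [Complex.ofReal_exp]; congr 1; push_cast; ring
  have e2 : cexp ((0 - 1 / 2) * ((-a : ℝ) : ℂ)) = ((Real.exp (a / 2) : ℝ) : ℂ) := by
    rw [Complex.ofReal_exp]; congr 1; push_cast; ring
  have e3 : cexp ((1 - 1 / 2) * (a : ℂ)) = ((Real.exp (a / 2) : ℝ) : ℂ) := by
    rw [Complex.ofReal_exp]; congr 1; push_cast; ring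
  have e4 : cexp ((1 - 1 / 2) * ((-a : ℝ) : ℂ)) = ((Real.exp (-(a / 2)) : ℝ) : ℂ) := by
    rw [Complex.ofReal_exp]; congr 1; push_cast; ring
  rw [e1, e2, e3, e4]
  constructor <;> push_cast <;> ring

/-- `(e^{a/2} + e^{-a/2})² ≥ e^{a}`. [folklore] -/
theorem exp_le_twoCosh_sq (a : ℝ) : Real.exp a ≤ (Real.exp (a / 2) + Real.exp (-(a / 2))) ^ 2 := by
  have h1 : Real.exp a = Real.exp (a / 2) ^ 2 := by rw [sq, ← Real.exp_add, add_halves]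
  rw [h1]
  nlinarith [Real.exp_pos (a / 2), Real.exp_pos (-(a / 2))]

/-- A non-negative bump `u` has `û(0), û(1)` real and positive. [folklore] -/
theorem exists_isWeilTest_weilMellin_zero_one_pos :
    ∃ u : ℝ → ℂ, IsWeilTest u ∧ ∃ I₀ I₁ : ℝ, 0 < I₀ ∧ 0 < I₁ ∧
      weilMellin u 0 = I₀ ∧ weilMellin u 1 = I₁ := by
  let b : ContDiffBump (0 : ℝ) := ⟨1, 2, one_pos, one_lt_two⟩
  have hu : IsWeilTest fun t ↦ ((b t : ℝ) : ℂ) :=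
    ⟨Complex.ofRealCLM.contDiff.comp b.contDiff, b.hasCompactSupport.comp_left Complex.ofReal_zero⟩
  have key : ∀ σ : ℝ, weilMellin (fun t ↦ ((b t : ℝ) : ℂ)) σ =
      ((∫ t : ℝ, b t * Real.exp ((σ - 1 / 2) * t) : ℝ) : ℂ) ∧
        0 < ∫ t : ℝ, b t * Real.exp ((σ - 1 / 2) * t) := by
    intro σ
    refine ⟨?_, ?_⟩
    · unfold weilMellin
      rw [← integral_complex_ofReal]
      congr 1 with t
      push_cast
      ring_nf
    · have hc : Continuous fun t : ℝ ↦ b t * Real.exp ((σ - 1 / 2) * t) :=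
        b.continuous.mul (by fun_prop)
      refine hc.integral_pos_of_hasCompactSupport_nonneg_nonzero b.hasCompactSupport.mul_right
        (fun t ↦ mul_nonneg (b.nonneg' t) (Real.exp_pos _).le) (x := 0) ?_
      have hb0 : b 0 = 1 := b.one_of_mem_closedBall (Metric.mem_closedBall_self zero_le_one)
      simp [hb0]
  refine ⟨_, hu, _, _, (key 0).2, (key 1).2, ?_, ?_⟩
  · simpa using (key 0).1
  · simpa using (key 1).1

/-! ## Cross sums over the zeros -/

/-- `∑_ρ m(ρ) |ĝ(ρ)| |ĥ(1 − ρ̄)| < ∞` for tests `g, h` (`|ĝ(ρ)| ≤ C_g/(1 + γ²)`). [folklore] -/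
theorem summable_norm_cross {g h : ℝ → ℂ} (hg : IsWeilTest g) (hh : IsWeilTest h) :
    Summable fun ρ : ZetaZeros.riemannZetaNontrivialZeros ↦
      ‖(riemannZetaZeroOrder (ρ : ℂ) : ℂ) *
        (weilMellin g ρ * conj (weilMellin h (1 - conj (ρ : ℂ))))‖ := by
  refine summable_norm_zeroSide_of_le (K := weilDecayConst g * weilDecayConst h)
    (a := fun s ↦ weilMellin g s * conj (weilMellin h (1 - conj s))) fun ρ hρ ↦ ?_
  have h1 : ‖weilMellin g ρ‖ ≤ weilDecayConst g / (1 + ρ.im ^ 2) :=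
    norm_weilMellin_le hg (ZetaZeros.riemannZetaNontrivialZeros.re_pos hρ).le
      (ZetaZeros.riemannZetaNontrivialZeros.re_lt_one hρ).le
  have h2 : ‖weilMellin h (1 - conj ρ)‖ ≤ weilDecayConst h / (1 + ρ.im ^ 2) := by
    have := norm_weilMellin_le hh (s := 1 - conj ρ)
      (by rw [one_sub_conj_re]; linarith [ZetaZeros.riemannZetaNontrivialZeros.re_lt_one hρ])
      (by rw [one_sub_conj_re]; linarith [ZetaZeros.riemannZetaNontrivialZeros.re_pos hρ])
    rwa [one_sub_conj_im] at this
  rw [norm_mul, Complex.norm_conj]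
  calc ‖weilMellin g ρ‖ * ‖weilMellin h (1 - conj ρ)‖
      ≤ weilDecayConst g / (1 + ρ.im ^ 2) * (weilDecayConst h / (1 + ρ.im ^ 2)) :=
        mul_le_mul h1 h2 (norm_nonneg _) (div_nonneg (weilDecayConst_nonneg g) (by positivity))
    _ = weilDecayConst g * weilDecayConst h / (1 + ρ.im ^ 2) ^ 2 := by
        rw [div_mul_div_comm, ← sq]

end Summit.RiemannHypothesis.RiemannHypothesis.Theorems

end
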